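import Summits.BirchSwinnertonDyer.Rank1Residual.X11b.BDPRouteOpenInputFieldRecord
import Summits.BirchSwinnertonDyer.Rank1Residual.X11b.BDPRouteTwistCertificateRecord
import HarnessLib

/-!
# Class X11b, route p2 at `p ≥ 5`: THE OPEN STATEMENT AT ITS WEAKEST IN THE DATUM DIRECTION (V) —
# THE CLASS RECORD with the main-conjecture half ABSTRACTED (`Typed.MissingLowerBoundAt` on the
# surjective pairs) and, through it, THE CLASS RECORD OVER ONE FIELD PER PAIR: `∀ (E,p) ∈ X11b,
# p ≥ 5 → BSD(E,p)` from the published facts and (2.4)∃♭ over ONE admissible Heegner field per pair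
# (value over that field only off the semistable pairs) + the per-pair certificates / conjecture /
# corner of gen 22 (cell `b2b-bsdres`, sub-cell `multr1-p2`, gen 27; file 5)

HONEST FRAMING (cell `b2b-bsdres`, run/shared/lean/b2b/bsd-rank1-residual/, verbatim in every
file): the goal of the cell is to DELETE the COMBINATION-SHAPED residual classes of the
Birch–Swinnerton-Dyer formula for ALL analytic-rank `≤ 1` elliptic curves over `ℚ` — "full BSD
formula for every rank `≤ 1` curve in class `C`" assembled STRICTLY from published theorems — so
that the rank-`≤ 1` remainder becomes exactly the CONSTRUCTION-SHAPED classes, which are TYPED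
(missing-input `Prop`s), NOT attempted. This is not "finishing BSD". Sub-cell `multr1-p2` is a
RESEARCH ROUTE on class X11b (`ClassX11b W p := r_an = 1 ∧ p ≠ 2 ∧ mult(p) ∧ irr(p)`); no claim
beyond the stated class and loci; X11b's label does not change; NOTHING is booked by this file.

THEOREMS ONLY (no definition, no named fact, no `sorry`).

## What this file proves

* **`P2.bsdp_of_onTree_of_lowerHalf`** — gen 22's class record
  `P2.bsdp_of_onTree_cyclotomic_twistCertificate` with its input (T1) (the composite open input
  `P2OpenInputOnTreeAt` at every pair) REPLACED by what the record uses of it: the main-conjecture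
  half `Typed.MissingLowerBoundAt W p` on the X11b ∧ surj pairs at `p ≥ 5`. All other inputs (the
  lever's facts, (REG) per pair, (TC) on split-only pairs with `p ∤ ∏c`, the exceptional conjecture
  on split-only pairs with `p ∣ ∏c`, the corner) VERBATIM; the dispatch is gen 21/22's.
* **`P2.bsdp_of_onTree_someFramesAtField`** — THE CLASS RECORD OVER ONE FIELD PER PAIR: `∀ (E,p) ∈`
  X11b, `p ≥ 5 → BSD(E,p)` from route p2's + the lever's published facts (+ `h32`), the cited
  `hPT`/`hEP`, and the typed inputs: **for every surjective pair ONE admissible Heegner field `K`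
  with (2.4)∃♭ over `K` — and value∃♭ over `K` when the pair is NOT semistable** —; (REG); (TC);
  the exceptional conjecture; the corner. Gen 25's `P2.bsdp_of_onTree_split` asked (2.4)∃♭ over
  ALL admissible fields of every pair (and the value shape over all of them off the semistable part).
* **`P2.bsdp_of_onTree_someFrames_prescribedFields`** — the same with, for a finite set `S` of primes
  and a bound `B` fixed once for the class (a source's hypotheses), (2.4)∃♭ (+ value off the
  semistable part) asked over every admissible `K` with the primes of `S` split, `d_K ≡ 1 (mod 8)`,
  `|d_K| > B` (file 2's Hoffstein–Luo supply provides one per pair).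

CONDITIONAL on the typed inputs ((2.4): PRE at `p ∥ N`; value: PUB shape off the semistable pairs;
REG / TC per pair; the conjecture; the corner); nothing booked; labels UNCHANGED; X11b stays
CONSTRUCTION-SHAPED.

## References

* [Castella2018] Thms. 2.3, 3.1, 3.2, §5 (arXiv:1704.06608 pp. 5, 9, 12). * [Castella2018Erratum] (2.4).
* [HoffsteinLuo1997] Theorem. * [McCallumLMS1991] §1 Theorem (Kolyvagin), p. 296.
* [Disegni2020] Thm. 1 (§1.2), Thm. 4, (∗). * [Wuthrich2014] Thm. 3 (p. 383), Prop. 21 (p. 400).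
* [SteinWuthrich2013] Thm. 6.1, §4.2. * [BalakrishnanEtAl2019] Thm. 1.2. * [Miller2011LMS] Def. 1.1.
-/

noncomputable section

open scoped Classical NumberField

open WeierstrassCurve NumberField IsDedekindDomain Field
open Literature.NumberTheory.EllipticCurves Literature.NumberTheory.EllipticCurves.GreenbergSelmer
  Literature.NumberTheory.EllipticCurves.ModularForms
  Literature.NumberTheory.EllipticCurves.Rank1Residual
  Literature.NumberTheory.EllipticCurves.Rank1Residual.Typed
  Literature.NumberTheory.EllipticCurves.Wuthrich2014
  Literature.NumberTheory.EllipticCurves.Castella2018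
  Literature.NumberTheory.EllipticCurves.SteinWuthrich2013
  Literature.NumberTheory.EllipticCurves.Disegni2020
  Literature.NumberTheory.EllipticCurves.Skinner2016
  Literature.NumberTheory.EllipticCurves.BalakrishnanEtAl2019
  Literature.NumberTheory.EllipticCurves.KrizLi2019
  Literature.NumberTheory.QuadraticFields.Quadratic
  Literature.NumberTheory.Automorphic
  Literature.NumberTheory.GaloisRepresentations Literature.NumberTheory.GaloisCohomology

namespace Summit.BirchSwinnertonDyer.Rank1Residual.X11b

/-! ### §1 The class record with the main-conjecture half abstracted -/

/-- **Route p2's class record at `p ≥ 5` with (T1) replaced by the main-conjecture half it yields.**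
`∀ (E, p) ∈` X11b, `p ≥ 5 → BSD(E, p)` from the lever's published facts (Kato's divisibility,
Stein–Wuthrich, Disegni, GZK, parametrisations), route p2's facts used by the twist certificate
(Gross–Zagier, Kolyvagin ×2, GZK, modularity, Mazur), BDMTV for the corner shape, and the typed
inputs: **(T1′) `Typed.MissingLowerBoundAt W p` on every X11b ∧ surj pair** (`ord_p #Ш_an ≤ ord_p #Ш`
— whatever supplies it: the composite open input class-wide (gen 18), over one field (gen 27), …);
(REG) per pair; (TC) one twist certificate per split-only pair with `p ∤ ∏c`; (T2∗′) the conjecture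
`RelativeExceptionalLeadingTermAt` on split-only pairs with `p ∣ ∏c`; (T4′) the corner. Dispatch of
gens 21/22 verbatim. CONDITIONAL; nothing booked. [cite: Wuthrich2014, Thm. 3 (p. 383)]
[cite: SteinWuthrich2013, Thm. 6.1, §4.2] [cite: Disegni2020, Thm. 1 (§1.2), (∗)]
[cite: McCallumLMS1991, §1 Theorem (Kolyvagin), p. 296] [cite: BalakrishnanEtAl2019, Thm. 1.2]
[cite: Miller2011LMS, Def. 1.1] -/
theorem P2.bsdp_of_onTree_of_lowerHalf
    -- route p2's published inputs (used by the twist certificate)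
    (hGZ : ∀ (N : ℕ) [NeZero N] (W : WeierstrassCurve ℚ) (K : Type) [Field K] [NumberField K],
      gross_zagier N W K)
    (hKo : ∀ (N : ℕ) [NeZero N] (W : WeierstrassCurve ℚ) (K : Type) [Field K] [NumberField K],
      kolyvagin N W K)
    (hB : ∀ (N : ℕ) [NeZero N] (W : WeierstrassCurve ℚ) (K : Type) [Field K] [NumberField K],
      Kolyvagin1990_padicValNat_card_sha_le N W K)
    (hGZK : rank_eq_analyticRank_of_analyticRank_le_one) (hmod : hasEntireLFunction_rat)
    (hnf : exists_isNewformOf) (hMaz : mazur_not_dvd_maninConstant_of_odd)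
    (hBDMTV : thm12_not_le_normalizer_splitCartan)
    -- the lever's published inputs
    (hK : kato_charIdeal_dvd_multiplicative_of_surjective)
    (hJn : thm61_nonsplitMultiplicative) (hJs : thm61_splitMultiplicative)
    (hHn : exists_isMultCanonical) (hHs : exists_isSplitMultCanonical)
    (hD : thm1_padicBSD_rankOne_multiplicative) (hpar : nonempty_modularParametrizationData)
    -- (T1′) the main-conjecture half on the surjective pairs
    (hLow : ∀ (W : WeierstrassCurve ℚ) [W.IsElliptic] [W.IsGloballyMinimal] (p : ℕ) [Fact p.Prime],
      ClassX11b W p → 5 ≤ p → Surj W p → Typed.MissingLowerBoundAt W p)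
    -- (REG)
    (hReg : ∀ (W : WeierstrassCurve ℚ) [W.IsElliptic] [W.IsGloballyMinimal] (p : ℕ) [Fact p.Prime],
      ClassX11b W p → 5 ≤ p → ClassClosure.RegulatorNonvanishingAt W p)
    -- (TC) ONE twist certificate per split-only pair with `p ∤ ∏c`
    (hTC : ∀ (W : WeierstrassCurve ℚ) [W.IsElliptic] [W.IsGloballyMinimal] (p : ℕ) [Fact p.Prime],
      ClassX11b W p → 5 ≤ p → W.HasSplitMultiplicativeReductionAtPrime p →
      (¬ ∃ (m : ℕ) (_ : Fact m.Prime), m ≠ p ∧ W.HasMultiplicativeReductionAtPrime m) →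
      ¬ p ∣ W.tamagawaProduct →
      ∃ (K : Type) (_ : Field K) (_ : NumberField K) (Wd : WeierstrassCurve ℚ) (_ : Wd.IsElliptic)
        (_ : Wd.IsGloballyMinimal) (Cd : VariableChange ℚ) (qd : ℚ),
        IsImaginaryQuadratic K ∧ SatisfiesHeegnerHypothesis (W.conductorNorm ℤ) K ∧
        NumberField.discr K < -4 ∧ Cd • W.quadraticTwist (NumberField.discr K : ℚ) = Wd ∧
        Wd.entireLFunction 1 / (Wd.realPeriodRat : ℂ) = (qd : ℂ) ∧ qd ≠ 0 ∧ padicValRat p qd = 0)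
    -- (T2∗′) the exceptional conjecture, only on split-only pairs with `p ∣ ∏c`
    (hC : ∀ (W : WeierstrassCurve ℚ) [W.IsElliptic] [W.IsGloballyMinimal] (p : ℕ) [Fact p.Prime],
      ClassX11b W p → 5 ≤ p → W.HasSplitMultiplicativeReductionAtPrime p →
      (¬ ∃ (m : ℕ) (_ : Fact m.Prime), m ≠ p ∧ W.HasMultiplicativeReductionAtPrime m) →
      p ∣ W.tamagawaProduct → ClassClosure.RelativeExceptionalLeadingTermAt W p)
    -- (T4′)
    (hCorner : ∀ (W : WeierstrassCurve ℚ) [W.IsElliptic] [W.IsGloballyMinimal] (p : ℕ)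
      [Fact p.Prime], ClassX11b W p → ¬ Surj W p → (p = 5 ∨ p = 7) →
        p ∣ padicValInt p W.minimalDiscriminantInt → ¬ Ram W p → Typed.MissingPPartAt W p)
    (W : WeierstrassCurve ℚ) [W.IsElliptic] [W.IsGloballyMinimal] (p : ℕ) [Fact p.Prime]
    (hX : ClassX11b W p) (hp5 : 5 ≤ p) : BSDp W p := by
  have hp2 : p ≠ 2 := hX.2.1
  by_cases hsurj : Surj W p
  · refine Typed.bsdp_of_missingPPartAt W p hGZK (by rw [hX.1])
      (Typed.missingPPartAt_of_lower_of_upper W p (hLow W p hX hp5 hsurj) ?_)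
    -- the Euler-system half
    by_cases hst : W.HasSplitMultiplicativeReductionAtPrime p →
        ∃ (m : ℕ) (_ : Fact m.Prime), m ≠ p ∧ W.HasMultiplicativeReductionAtPrime m
    · -- non-split, or split with a second multiplicative prime: the lever with (REG)
      exact missingUpperBoundAt_of_katoSurj_of_regulatorNonvanishing W p hK hJn hJs hHn hHs hD hGZK
        hpar hp5 hX.2.2.1 hX.1 hsurj hst (hReg W p hX hp5)
    · rw [Classical.not_imp] at hst
      obtain ⟨hsplit, hm⟩ := hst
      by_cases htam : p ∣ W.tamagawaProduct
      · -- split-only with `p ∣ ∏c`: the exceptional conjecture road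
        exact missingUpperBoundAt_of_katoSurj_split_of_relativeLeadingTerm W p hK hJs hHs hGZK hpar hp2
          hX.2.2.1 hsplit hX.1
          (kato_charIdeal_dvd_multiplicative_of_surjective.surjective_pow_of_five_le W p hp5 hsurj)
          (hC W p hX hp5 hsplit hm htam) (hReg W p hX hp5).2
      · -- split-only with `p ∤ ∏c`: the twist certificate
        obtain ⟨K, _, _, Wd, _, _, Cd, qd, hK', hHN, hdK, hWd, hqd, hqd0, hvd⟩ :=
          hTC W p hX hp5 hsplit hm htam
        exact missingUpperBoundAt_of_classX11b_of_twistUnit W p hGZ hKo hB hGZK hmod hnf hMaz hX hp5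
          hsurj htam K hK' hHN hdK Wd Cd hWd qd hqd hqd0 hvd
  · -- the non-surjective corner, localised
    obtain ⟨h57, hdvd, hnram⟩ := ClassX11b.not_surj_shape W p hBDMTV hX hp5 hsurj
    exact Typed.bsdp_of_missingPPartAt W p hGZK (by rw [hX.1]) (hCorner W p hX hsurj h57 hdvd hnram)

/-! ### §2 The class record over ONE field per pair -/

/-- **ROUTE p2 — THE CLASS RECORD OVER ONE FIELD PER PAIR (gen 27).** `∀ (E, p) ∈` X11b,
`p ≥ 5 → BSD(E, p)` from route p2's and the lever's published named facts (+ Kolyvagin 1990 Thm. A,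
Cas18 Thms. 3.1–3.2 `h32`, BDMTV), the cited Poitou–Tate / local Euler characteristic, and the typed
inputs: **(T1″) for every X11b ∧ surj pair ONE imaginary quadratic `K` — `d_K` odd, `p ∤ d_K`,
`p ∤ w_K`, every `ℓ ∣ N_E` split, `L(E^{d_K},1) ≠ 0` — with (2.4)∃♭ over `K`
(`P2.IMCDivSomeFrameOnTreeAtField W p K`, THE open statement) and, when the pair is NOT semistable,
value∃♭ over `K` (`P2.BDPValueSomeFrameOnTreeAtField W p K`, PUB shape)**; (REG) per pair; (TC) on
split-only pairs with `p ∤ ∏c`; the exceptional conjecture on split-only pairs with `p ∣ ∏c`; the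
corner. §1 with (T1′) from file 3's `P2.openInputOnTreeAtField_of_someFrames` (value from `h32` on
semistable pairs) and file 1's `P2.missingLowerBoundAt_of_openInputAtField`. Gen 25's
`P2.bsdp_of_onTree_split` asked both shapes over ALL admissible fields of the pair. CONDITIONAL;
nothing booked; labels UNCHANGED; X11b stays CONSTRUCTION-SHAPED. [cite: Castella2018Erratum, (2.4) (p. 4)]
[cite: Castella2018, Thms. 2.3, 3.1, 3.2, §5] [cite: McCallumLMS1991, §1 Theorem (Kolyvagin), p. 296]
[cite: Disegni2020, Thm. 1 (§1.2), (∗)] [cite: Wuthrich2014, Thm. 3 (p. 383), Prop. 21 (p. 400)]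
[cite: SteinWuthrich2013, Thm. 6.1, §4.2] [cite: BalakrishnanEtAl2019, Thm. 1.2] [cite: Miller2011LMS, Def. 1.1] -/
theorem P2.bsdp_of_onTree_someFramesAtField
    -- route p2's published inputs
    (hGZ : ∀ (N : ℕ) [NeZero N] (W : WeierstrassCurve ℚ) (K : Type) [Field K] [NumberField K],
      gross_zagier N W K)
    (hKo : ∀ (N : ℕ) [NeZero N] (W : WeierstrassCurve ℚ) (K : Type) [Field K] [NumberField K],
      kolyvagin N W K)
    (hB : ∀ (N : ℕ) [NeZero N] (W : WeierstrassCurve ℚ) (K : Type) [Field K] [NumberField K],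
      Kolyvagin1990_padicValNat_card_sha_le N W K)
    (hWu : sha_dvd_analyticSha) (hGZK : rank_eq_analyticRank_of_analyticRank_le_one)
    (hnf : exists_isNewformOf) (hMaz : mazur_not_dvd_maninConstant_of_odd)
    (hBDMTV : thm12_not_le_normalizer_splitCartan)
    (hPT : ∀ (K : Type) [Field K] [NumberField K], poitouTate_sum_localTatePairing_eq_zero K)
    (hEP : ∀ (K : Type) [Field K] [NumberField K] (v : HeightOneSpectrum (𝓞 K)),
      localEulerPoincareCharacteristic (v.adicCompletion K))
    -- Castella 2018 Thms. 3.1–3.2 (PUBLISHED; semistable scope)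
    (h32 : thm32_exists_isBDPLFunction_valueAtOne)
    -- the lever's published inputs
    (hK : kato_charIdeal_dvd_multiplicative_of_surjective)
    (hJn : thm61_nonsplitMultiplicative) (hJs : thm61_splitMultiplicative)
    (hHn : exists_isMultCanonical) (hHs : exists_isSplitMultCanonical)
    (hD : thm1_padicBSD_rankOne_multiplicative) (hpar : nonempty_modularParametrizationData)
    -- (T1″) ONE admissible field per surjective pair, with (2.4)∃♭ over it (+ value off semistable)
    (hField : ∀ (W : WeierstrassCurve ℚ) [W.IsElliptic] [W.IsGloballyMinimal] (p : ℕ) [Fact p.Prime],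
      ClassX11b W p → 5 ≤ p → Surj W p →
      ∃ (K : Type) (_ : Field K) (_ : NumberField K), IsImaginaryQuadratic K ∧
        Odd (NumberField.discr K) ∧ ¬ (p : ℤ) ∣ NumberField.discr K ∧ ¬ p ∣ Units.torsionOrder K ∧
        SatisfiesHeegnerHypothesis (W.conductorNorm ℤ) K ∧
        (W.quadraticTwist (NumberField.discr K : ℚ)).entireLFunction 1 ≠ 0 ∧
        P2.IMCDivSomeFrameOnTreeAtField W p K ∧
        (¬ Semistable W → P2.BDPValueSomeFrameOnTreeAtField W p K))
    -- (REG)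
    (hReg : ∀ (W : WeierstrassCurve ℚ) [W.IsElliptic] [W.IsGloballyMinimal] (p : ℕ) [Fact p.Prime],
      ClassX11b W p → 5 ≤ p → ClassClosure.RegulatorNonvanishingAt W p)
    -- (TC)
    (hTC : ∀ (W : WeierstrassCurve ℚ) [W.IsElliptic] [W.IsGloballyMinimal] (p : ℕ) [Fact p.Prime],
      ClassX11b W p → 5 ≤ p → W.HasSplitMultiplicativeReductionAtPrime p →
      (¬ ∃ (m : ℕ) (_ : Fact m.Prime), m ≠ p ∧ W.HasMultiplicativeReductionAtPrime m) →
      ¬ p ∣ W.tamagawaProduct →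
      ∃ (K : Type) (_ : Field K) (_ : NumberField K) (Wd : WeierstrassCurve ℚ) (_ : Wd.IsElliptic)
        (_ : Wd.IsGloballyMinimal) (Cd : VariableChange ℚ) (qd : ℚ),
        IsImaginaryQuadratic K ∧ SatisfiesHeegnerHypothesis (W.conductorNorm ℤ) K ∧
        NumberField.discr K < -4 ∧ Cd • W.quadraticTwist (NumberField.discr K : ℚ) = Wd ∧
        Wd.entireLFunction 1 / (Wd.realPeriodRat : ℂ) = (qd : ℂ) ∧ qd ≠ 0 ∧ padicValRat p qd = 0)
    -- (T2∗′)
    (hC : ∀ (W : WeierstrassCurve ℚ) [W.IsElliptic] [W.IsGloballyMinimal] (p : ℕ) [Fact p.Prime],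
      ClassX11b W p → 5 ≤ p → W.HasSplitMultiplicativeReductionAtPrime p →
      (¬ ∃ (m : ℕ) (_ : Fact m.Prime), m ≠ p ∧ W.HasMultiplicativeReductionAtPrime m) →
      p ∣ W.tamagawaProduct → ClassClosure.RelativeExceptionalLeadingTermAt W p)
    -- (T4′)
    (hCorner : ∀ (W : WeierstrassCurve ℚ) [W.IsElliptic] [W.IsGloballyMinimal] (p : ℕ)
      [Fact p.Prime], ClassX11b W p → ¬ Surj W p → (p = 5 ∨ p = 7) →
        p ∣ padicValInt p W.minimalDiscriminantInt → ¬ Ram W p → Typed.MissingPPartAt W p)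
    (W : WeierstrassCurve ℚ) [W.IsElliptic] [W.IsGloballyMinimal] (p : ℕ) [Fact p.Prime]
    (hX : ClassX11b W p) (hp5 : 5 ≤ p) : BSDp W p := by
  have hmod : hasEntireLFunction_rat := hasEntireLFunction_rat_of_exists_isNewformOf hnf
  refine P2.bsdp_of_onTree_of_lowerHalf hGZ hKo hB hGZK hmod hnf hMaz hBDMTV hK hJn hJs hHn hHs hD hpar
    ?_ hReg hTC hC hCorner W p hX hp5
  intro W _ _ p _ hX hp5 hsurj
  obtain ⟨K, _, _, hK', hodd, hpd, hμ, hHN, hLt, hDiv, hVal⟩ := hField W p hX hp5 hsurj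
  -- the value shape over `K`: `h32` on semistable pairs, the typed input otherwise
  have hV : P2.BDPValueSomeFrameOnTreeAtField W p K := by
    by_cases hss : Semistable W
    · exact P2.bdpValueSomeFrameOnTreeAtField_of_thm32_of_semistable h32 hss
    · exact hVal hss
  exact P2.missingLowerBoundAt_of_openInputAtField W p hGZ hKo hWu hGZK hmod hnf hMaz hPT hEP hK' hodd
    hpd hμ hHN hLt (P2.openInputOnTreeAtField_of_someFrames hnf hGZK hKo hPT hEP hDiv hV) hX hp5 hsurj

/-- **ROUTE p2 — THE CLASS RECORD OVER THE PRESCRIBED FIELDS (gen 27).** As above, with (T1″)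
replaced by: for a finite set `S` of primes and a bound `B` fixed for the class (a source's
hypotheses), at every X11b ∧ surj pair (2.4)∃♭ over `K` (+ value∃♭ over `K` off the semistable
pairs) for EVERY imaginary quadratic `K` with `d_K ≡ 1 (mod 8)`, `|d_K| > B`, the primes of `S`
split, every `ℓ ∣ N_E` and `p` split, `L(E^{d_K},1) ≠ 0` — file 2's Hoffstein–Luo supply
(`exists_admissibleField_splitAt`) gives one such field per pair. CONDITIONAL; nothing booked;
labels UNCHANGED; X11b stays CONSTRUCTION-SHAPED. [cite: HoffsteinLuo1997, Theorem]
[cite: Castella2018Erratum, (2.4) (p. 4)] [cite: Castella2018, Thms. 2.3, 3.1, 3.2, §5]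
[cite: Disegni2020, Thm. 1 (§1.2), (∗)] [cite: Wuthrich2014, Thm. 3 (p. 383), Prop. 21 (p. 400)]
[cite: BalakrishnanEtAl2019, Thm. 1.2] [cite: Miller2011LMS, Def. 1.1] -/
theorem P2.bsdp_of_onTree_someFrames_prescribedFields
    (hGZ : ∀ (N : ℕ) [NeZero N] (W : WeierstrassCurve ℚ) (K : Type) [Field K] [NumberField K],
      gross_zagier N W K)
    (hKo : ∀ (N : ℕ) [NeZero N] (W : WeierstrassCurve ℚ) (K : Type) [Field K] [NumberField K],
      kolyvagin N W K)
    (hB : ∀ (N : ℕ) [NeZero N] (W : WeierstrassCurve ℚ) (K : Type) [Field K] [NumberField K],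
      Kolyvagin1990_padicValNat_card_sha_le N W K)
    (hWu : sha_dvd_analyticSha) (hGZK : rank_eq_analyticRank_of_analyticRank_le_one)
    (hnf : exists_isNewformOf) (hHL : HoffsteinLuo1997_exists_twist_L_one_ne_zero)
    (hMaz : mazur_not_dvd_maninConstant_of_odd) (hBDMTV : thm12_not_le_normalizer_splitCartan)
    (hPT : ∀ (K : Type) [Field K] [NumberField K], poitouTate_sum_localTatePairing_eq_zero K)
    (hEP : ∀ (K : Type) [Field K] [NumberField K] (v : HeightOneSpectrum (𝓞 K)),
      localEulerPoincareCharacteristic (v.adicCompletion K))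
    (h32 : thm32_exists_isBDPLFunction_valueAtOne)
    (hK : kato_charIdeal_dvd_multiplicative_of_surjective)
    (hJn : thm61_nonsplitMultiplicative) (hJs : thm61_splitMultiplicative)
    (hHn : exists_isMultCanonical) (hHs : exists_isSplitMultCanonical)
    (hD : thm1_padicBSD_rankOne_multiplicative) (hpar : nonempty_modularParametrizationData)
    -- the source's hypotheses on the field, fixed for the class
    (S : Finset ℕ) (hS : ∀ q ∈ S, q.Prime) (B : ℕ)
    -- (T1‴) (2.4)∃♭ (+ value off semistable) over the prescribed fields, at every surjective pair
    (hField : ∀ (W : WeierstrassCurve ℚ) [W.IsElliptic] [W.IsGloballyMinimal] (p : ℕ) [Fact p.Prime],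
      ClassX11b W p → 5 ≤ p → Surj W p →
      ∀ (K : Type) [Field K] [NumberField K], IsImaginaryQuadratic K →
        NumberField.discr K % 8 = 1 → B < (NumberField.discr K).natAbs →
        (∀ q ∈ S, SatisfiesHeegnerHypothesis q K) →
        SatisfiesHeegnerHypothesis (W.conductorNorm ℤ) K → SatisfiesHeegnerHypothesis p K →
        (W.quadraticTwist (NumberField.discr K : ℚ)).entireLFunction 1 ≠ 0 →
        P2.IMCDivSomeFrameOnTreeAtField W p K ∧
        (¬ Semistable W → P2.BDPValueSomeFrameOnTreeAtField W p K))
    (hReg : ∀ (W : WeierstrassCurve ℚ) [W.IsElliptic] [W.IsGloballyMinimal] (p : ℕ) [Fact p.Prime],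
      ClassX11b W p → 5 ≤ p → ClassClosure.RegulatorNonvanishingAt W p)
    (hTC : ∀ (W : WeierstrassCurve ℚ) [W.IsElliptic] [W.IsGloballyMinimal] (p : ℕ) [Fact p.Prime],
      ClassX11b W p → 5 ≤ p → W.HasSplitMultiplicativeReductionAtPrime p →
      (¬ ∃ (m : ℕ) (_ : Fact m.Prime), m ≠ p ∧ W.HasMultiplicativeReductionAtPrime m) →
      ¬ p ∣ W.tamagawaProduct →
      ∃ (K : Type) (_ : Field K) (_ : NumberField K) (Wd : WeierstrassCurve ℚ) (_ : Wd.IsElliptic)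
        (_ : Wd.IsGloballyMinimal) (Cd : VariableChange ℚ) (qd : ℚ),
        IsImaginaryQuadratic K ∧ SatisfiesHeegnerHypothesis (W.conductorNorm ℤ) K ∧
        NumberField.discr K < -4 ∧ Cd • W.quadraticTwist (NumberField.discr K : ℚ) = Wd ∧
        Wd.entireLFunction 1 / (Wd.realPeriodRat : ℂ) = (qd : ℂ) ∧ qd ≠ 0 ∧ padicValRat p qd = 0)
    (hC : ∀ (W : WeierstrassCurve ℚ) [W.IsElliptic] [W.IsGloballyMinimal] (p : ℕ) [Fact p.Prime],
      ClassX11b W p → 5 ≤ p → W.HasSplitMultiplicativeReductionAtPrime p →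
      (¬ ∃ (m : ℕ) (_ : Fact m.Prime), m ≠ p ∧ W.HasMultiplicativeReductionAtPrime m) →
      p ∣ W.tamagawaProduct → ClassClosure.RelativeExceptionalLeadingTermAt W p)
    (hCorner : ∀ (W : WeierstrassCurve ℚ) [W.IsElliptic] [W.IsGloballyMinimal] (p : ℕ)
      [Fact p.Prime], ClassX11b W p → ¬ Surj W p → (p = 5 ∨ p = 7) →
        p ∣ padicValInt p W.minimalDiscriminantInt → ¬ Ram W p → Typed.MissingPPartAt W p)
    (W : WeierstrassCurve ℚ) [W.IsElliptic] [W.IsGloballyMinimal] (p : ℕ) [Fact p.Prime]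
    (hX : ClassX11b W p) (hp5 : 5 ≤ p) : BSDp W p := by
  refine P2.bsdp_of_onTree_someFramesAtField hGZ hKo hB hWu hGZK hnf hMaz hBDMTV hPT hEP h32 hK hJn
    hJs hHn hHs hD hpar ?_ hReg hTC hC hCorner W p hX hp5
  intro W _ _ p _ hX hp5 hsurj
  have hr : W.analyticRank = 1 := hX.1
  have hp2 : p ≠ 2 := hX.2.1
  have hw : W.rootNumber = -1 := by
    rw [WeierstrassCurve.rootNumber_eq_neg_one_pow_analyticRank_of_exists_isNewformOf hnf W, hr]
    norm_num
  obtain ⟨K, _, _, hK', hd8, hBK, hHN, hHp, hHS, hLt⟩ :=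
    exists_admissibleField_splitAt W p hnf hHL hw S hS (max B 4)
  have hB' : B < (NumberField.discr K).natAbs := lt_of_le_of_lt (le_max_left _ _) hBK
  have h4 : 4 < (NumberField.discr K).natAbs := lt_of_le_of_lt (le_max_right _ _) hBK
  obtain ⟨hodd, hpd, hμ⟩ := admissible_of_discr_mod_eight p hK' hd8 h4 hp2 hHp
  obtain ⟨hDiv, hVal⟩ := hField W p hX hp5 hsurj K hK' hd8 hB' hHS hHN hHp hLt
  exact ⟨K, inferInstance, inferInstance, hK', hodd, hpd, hμ, hHN, hLt, hDiv, hVal⟩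

end Summit.BirchSwinnertonDyer.Rank1Residual.X11b

end
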